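/-
Copyright (c) 2026 the pub-hodgecm-mathlib formalisation cell (harness21).  Prover seat hodgecm-mathlib-F0P2-p08 (g3), Track B «K2-LIT»,
#184♮ = hLiu418 = `stmt-HodgeConjecture-24832`; socket #41 `sig_K2LiuSiegelEisensteinContinuation`, KIND W, brick (x-a-int-rec): the JOINT integrability letter `hint` of
★ ED. 4 OF RECORD — for the (KW-fac) readings of a standard family, from ★ letters only (★ (x-a-int-fac) ∘ ★ (x-a-pres)(i) `hintArch_of_std`).
THEOREMS ONLY (no `def`, no `instance`, no notation, no named-fact hypothesis, no `sorry`).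
-/
import Summits.HodgeConjecture.HodgeConjecture.Theorems.K2LiuKindWFactorLetters                 -- ★ (x-a-int-fac) `hint_joint_of_reading`
import Summits.HodgeConjecture.HodgeConjecture.Theorems.K2LiuKindWArchLetterIntegrableBridge    -- ★ (x-a-pres)(i) `hintArch_of_std`
import HarnessLib

/-!
# Crux `HLiu418`, socket #41, KIND W — brick (x-a-int-rec) `K2LiuKindWJointIntegrableOfRecord`: THE JOINT LETTER `hint` OF ★ ED. 4 FOR A STANDARD FAMILY'S READINGS,
# FROM ★ LETTERS ONLY — one head for the tie instead of two compositions

Cell `hodgecm-mathlib`, crux item hLiu418 = `stmt-HodgeConjecture-24832` (helper lane `--supports … --as helper`, count-neutral), route of record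
`HCCMUnconditional`; squad K2 ∕ K2Liu, road `K2_Liu`, socket #41, KIND W; KW desk of record F0P2-p08 (g3).  The letter `hint` (joint integrability of each pure-tensor
summand on `N_Δ(L⁺⊗ℝ) × ∏_{v∈T} N_Δ(L⁺_v)`, ★ ED. 4 :108–123 ∕ ★ `kindW_block_cm_of_localLetters` slot) is, for the (KW-fac) READINGS of a standard section family
(`FinfT j S h s a := H_𝒦(a)^{2(s−s₀)}·A_j a`, `FvT j S h v s y := if v ∈ S₀ then H_v(y)^{2(s−s₀)}·b_{j,v} y else Λ_{s,v} y`, ★ p863379 ∕ ★ p863597), the COMPOSITION of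
★ p863446 `K2LiuKindWFactorLetters.hint_joint_of_reading` (per-place side: smooth local Siegel factors, ★ (iii-fin-int)) with ★ p863520
`K2LiuKindWArchLetterIntegrableBridge.hintArch_of_std` (archimedean side: flat tube presentation ★ FILE 18 + frame compact conjugator ★ FILE 21, unconditional).
THIS FILE is that composition as ONE head **`hint_of_std`**, so the tie binds the `hint` slot with a single name.  Inputs (all available at the tie BY NAME): the
(KW-fac) letters `hχS₀ hb hAlaw hfin hAc` (★ `exists_kindW_factorization_readings`), the readings `hreadArch hread` (`rfl`), `ht : χ.HasUnitaryArchType t 0` (★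
dictionary from `hlam`), `χ` unitary (★ `isUnitary_toHeckeCharacter`), the Iwasawa datum `𝒦` standard (`_h𝒦`), Haar carriers `νv` (σ-finite) and `νinf` (Haar — ★ p863588
`exists_kindW_carrierLetters_haar`).
[KudlaRallis1994, §1–§2] [Tan1999, §3] [Shimura1997, §16.4, §18.4] [Folland1995, §2.3].
HONEST LABEL.  Count-neutral helper; closes no socket by itself: `HC_CM` is proved only modulo the 7 printed citations (2 remaining named inputs:
hLiu418 = `stmt-HodgeConjecture-24832`, h413 = `stmt-HodgeConjecture-24833`) until rung 0 closes.

## References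
* [KudlaRallis1994] S. Kudla, S. Rallis, Ann. of Math. 140 (1994): §1–§2.   * [Tan1999] V. Tan, Canad. J. Math. 51 (1999): §3.
* [Shimura1997] G. Shimura, CBMS 93 (1997): §16.4, §18.4.   * [Folland1995] G. Folland, *A Course in Abstract Harmonic Analysis* (1995): §2.3.
-/

set_option autoImplicit false
-- the mandated namespace repeats the single-problem summit's segment (`HodgeConjecture.HodgeConjecture`)
set_option linter.dupNamespace false

noncomputable section

open scoped Matrix ComplexConjugate NNReal ENNReal BigOperators
open NumberField IsDedekindDomain Matrix MeasureTheory Measure Set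
open Literature.NumberTheory.Automorphic hiding IsKFinite
open Literature.NumberTheory.Automorphic.UnitaryGroup Literature.NumberTheory.GaloisRepresentations
open Literature.NumberTheory.LFunctions
open Literature.NumberTheory.GelbartRogawski1991 Literature.NumberTheory.GelbartRogawski1991.GRConstruction
open Literature.NumberTheory.GelbartRogawski1991.UnitaryDualPair
open Literature.NumberTheory.K2Lit Literature.NumberTheory.K2Lit.SiegelDoubled Literature.NumberTheory.K2Lit.LocalSiegelDoubled Literature.NumberTheory.K2Lit.PlaceSplitting
open Summit.HodgeConjecture.HodgeConjecture.Cruxes.HLiu418.K2LiuSiegelUnipotentFourierDefs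
open Summit.HodgeConjecture.HodgeConjecture.Cruxes.HLiu418.K2LiuSiegelUnipotentLocalDefs
open Summit.HodgeConjecture.HodgeConjecture.Cruxes.HLiu418.K2LiuSiegelUnipotentSplitDefs
open Summit.HodgeConjecture.HodgeConjecture.Cruxes.HLiu418.K2LiuSiegelEisensteinKindWLetters
open Summit.HodgeConjecture.HodgeConjecture.Cruxes.HLiu418.K2LiuKindWFactorLetters (hint_joint_of_reading)
open Summit.HodgeConjecture.HodgeConjecture.Cruxes.HLiu418.K2LiuKindWArchLetterIntegrableBridge (hintArch_of_std)

namespace Summit.HodgeConjecture.HodgeConjecture.Cruxes.HLiu418.K2LiuKindWJointIntegrableOfRecord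

variable (L : Type) [Field L] [NumberField L] [IsCMField L]
variable {N M : ℕ} (e : Fin N × Fin M ≃ Fin 2)
  (dV : Fin N → L) (hdV : ∀ i, IsCMField.complexConj L (dV i) = dV i)
  (dW : Fin M → L) (hdW : ∀ i, IsCMField.complexConj L (dW i) = dW i)
  (hdV0 : ∀ i, dV i ≠ 0) (hdW0 : ∀ i, dW i ≠ 0)
  [DecidableEq (HeightOneSpectrum (𝓞 (Fp L)))]
  [MeasurableSpace ↥(unipDeltaArch L e dV hdV dW hdW)] [BorelSpace ↥(unipDeltaArch L e dV hdV dW hdW)]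
  [∀ v : HeightOneSpectrum (𝓞 (Fp L)), MeasurableSpace ↥(unipDeltaLoc L e dV hdV dW hdW v)]
  [∀ v : HeightOneSpectrum (𝓞 (Fp L)), BorelSpace ↥(unipDeltaLoc L e dV hdV dW hdW v)]

include hdV0 hdW0 in
/-- **THE JOINT LETTER `hint` OF ★ ED. 4 OF RECORD** (`n := 2`): for the (KW-fac) readings `FinfT`, `FvT` of a standard section family — letters `hχS₀ hb` (local), `hAlaw hfin hAc`
(archimedean), readings `hreadArch hread`, `ht`, `hχu`, `𝒦` standard, Haar carriers — ★ ED. 4's `hint` VERBATIM, by ★ `hint_joint_of_reading` ∘ ★ `hintArch_of_std`.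
[cite: KudlaRallis1994, §1–§2] [cite: Tan1999, §3] [cite: Shimura1997, §16.4] -/
theorem hint_of_std {χ : HeckeCharacter L} (hχu : χ.IsUnitary) {t : InfinitePlace L → ℤ} (ht : χ.HasUnitaryArchType t 0)
    (𝒦 : IwasawaDatum L e dV hdV dW hdW) (h𝒦 : 𝒦.IsStd) (s₀ : ℂ)
    {S₀ : Finset (HeightOneSpectrum (𝓞 (Fp L)))} (hχS₀ : ∀ v, v ∉ S₀ → ∀ w : UnitaryGroup.PlacesOver L v, χ.IsUnramifiedAt w.1) {m : ℕ}
    (A : Fin m → UnitaryGroup.arch (Fp L) L (IsCMField.complexConj L) (2 + 2) (hermD L e dV hdV dW hdW) → ℂ)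
    (hAlaw : ∀ j, ∀ p : HA L e dV hdV dW hdW, IsSiegelDelta L e dV hdV dW hdW p → UnitaryGroup.finPart (Fp L) L (IsCMField.complexConj L) (2 + 2) (hermD L e dV hdV dW hdW) p = 1 →
      ∀ x : UnitaryGroup.arch (Fp L) L (IsCMField.complexConj L) (2 + 2) (hermD L e dV hdV dW hdW),
        A j (UnitaryGroup.archPart (Fp L) L (IsCMField.complexConj L) (2 + 2) (hermD L e dV hdV dW hdW) p * x) = siegelDeltaCharacter L e dV hdV dW hdW χ s₀ p * A j x)
    (hfin : ∀ j, ∃ V : Submodule ℂ (UnitaryGroup.arch (Fp L) L (IsCMField.complexConj L) (2 + 2) (hermD L e dV hdV dW hdW) → ℂ), FiniteDimensional ℂ V ∧ A j ∈ V ∧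
      ∀ a₀ : UnitaryGroup.arch (Fp L) L (IsCMField.complexConj L) (2 + 2) (hermD L e dV hdV dW hdW),
        (UnitaryGroup.archToAdelic (Fp L) L (IsCMField.complexConj L) (2 + 2) (hermD L e dV hdV dW hdW) a₀ : HA L e dV hdV dW hdW) ∈ 𝒦.K → ∀ G ∈ V, (fun x => G (x * a₀)) ∈ V)
    (hAc : ∀ j, Continuous (A j))
    (T₀ : Finset (HeightOneSpectrum (𝓞 (Fp L))))
    (νinf : Finset (HeightOneSpectrum (𝓞 (Fp L))) → Measure ↥(unipDeltaArch L e dV hdV dW hdW)) [∀ T' : Finset (HeightOneSpectrum (𝓞 (Fp L))), (νinf T').IsHaarMeasure]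
    (νv : ∀ v : HeightOneSpectrum (𝓞 (Fp L)), Measure ↥(unipDeltaLoc L e dV hdV dW hdW v)) [∀ v, (νv v).IsHaarMeasure] [∀ v, SigmaFinite (νv v)]
    (FinfT : Fin m → skewMatrices ((IsCMField.complexConj L : L ≃ₐ[Fp L] L) : L →+* L) ((gramR L e dV hdV dW hdW).map (algebraMap (Fp L) L)) →
      HA L e dV hdV dW hdW → ℂ → UnitaryGroup.arch (Fp L) L (IsCMField.complexConj L) (2 + 2) (hermD L e dV hdV dW hdW) → ℂ)
    (hreadArch : ∀ (S : skewMatrices ((IsCMField.complexConj L : L ≃ₐ[Fp L] L) : L →+* L) ((gramR L e dV hdV dW hdW).map (algebraMap (Fp L) L))) (h : HA L e dV hdV dW hdW)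
      (s : ℂ) (j : Fin m) (a : UnitaryGroup.arch (Fp L) L (IsCMField.complexConj L) (2 + 2) (hermD L e dV hdV dW hdW)),
      FinfT j S h s a = (((modDelta L e dV hdV dW hdW (𝒦.pPart (UnitaryGroup.archToAdelic (Fp L) L (IsCMField.complexConj L) (2 + 2) (hermD L e dV hdV dW hdW) a)) : ℝ) : ℂ) ^
        (2 * (s - s₀))) * A j a)
    (b : Fin m → (v : HeightOneSpectrum (𝓞 (Fp L))) → (UnitaryGroup.localPi L (IsCMField.complexConj L) (2 + 2) (hermD L e dV hdV dW hdW) v → ℂ))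
    (hb : ∀ i, ∀ v ∈ S₀, ∀ s : ℂ, (fun u => ((modDelta L e dV hdV dW hdW (𝒦.pPart (locToAdelic L e dV hdV dW hdW v u)) : ℝ) : ℂ) ^ (2 * (s - s₀)) * b i v u) ∈
      localDegPS (Fp L) L (IsCMField.complexConj L) (complexConj_imagUnit L) (imagUnit_ne_zero L) (imagUnit_mul_self L)
        v 2 (gramR_isSymm L e dV hdV dW hdW) (hermD_eq_map_gramD L e dV hdV dW hdW) (fun w => χ.localComponent w.1) s)
    (FvT : Fin m → ∀ (S : skewMatrices ((IsCMField.complexConj L : L ≃ₐ[Fp L] L) : L →+* L) ((gramR L e dV hdV dW hdW).map (algebraMap (Fp L) L)))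
      (h : HA L e dV hdV dW hdW) (v : (kindWFinset L e dV hdV dW hdW T₀ (S : Matrix (Fin 2) (Fin 2) L) h)),
      ℂ → UnitaryGroup.localPi L (IsCMField.complexConj L) (2 + 2) (hermD L e dV hdV dW hdW) v.1 → ℂ)
    (hread : ∀ (j : Fin m) (S : skewMatrices ((IsCMField.complexConj L : L ≃ₐ[Fp L] L) : L →+* L) ((gramR L e dV hdV dW hdW).map (algebraMap (Fp L) L)))
      (h : HA L e dV hdV dW hdW) (v : (kindWFinset L e dV hdV dW hdW T₀ (S : Matrix (Fin 2) (Fin 2) L) h)) (s : ℂ)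
      (y : UnitaryGroup.localPi L (IsCMField.complexConj L) (2 + 2) (hermD L e dV hdV dW hdW) v.1),
      FvT j S h v s y = if v.1 ∈ S₀ then ((modDelta L e dV hdV dW hdW (𝒦.pPart (locToAdelic L e dV hdV dW hdW v.1 y)) : ℝ) : ℂ) ^ (2 * (s - s₀)) * b j v.1 y
        else LambdaLoc L e dV hdV dW hdW v.1 χ s y) :
    ∀ (S : skewMatrices ((IsCMField.complexConj L : L ≃ₐ[Fp L] L) : L →+* L) ((gramR L e dV hdV dW hdW).map (algebraMap (Fp L) L))) (h : HA L e dV hdV dW hdW) (s : ℂ) (j : Fin m),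
      ((2 : ℕ) : ℝ) / 2 < s.re → (S : Matrix (Fin 2) (Fin 2) L).det ≠ 0 →
      Integrable (fun p : ↥(unipDeltaArch L e dV hdV dW hdW) × (Π v : (kindWFinset L e dV hdV dW hdW T₀ (S : Matrix (Fin 2) (Fin 2) L) h), ↥(unipDeltaLoc L e dV hdV dW hdW v.1)) =>
      (conj (unipDeltaChar L e dV hdV dW hdW (S : Matrix (Fin 2) (Fin 2) L)
            (UnitaryGroup.archToAdelic (Fp L) L (IsCMField.complexConj L) (2 + 2) (hermD L e dV hdV dW hdW)
              (p.1 : UnitaryGroup.arch (Fp L) L (IsCMField.complexConj L) (2 + 2) (hermD L e dV hdV dW hdW))) : ℂ) *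
          ∏ v : (kindWFinset L e dV hdV dW hdW T₀ (S : Matrix (Fin 2) (Fin 2) L) h), conj (unipDeltaChar L e dV hdV dW hdW (S : Matrix (Fin 2) (Fin 2) L)
            (locToAdelic L e dV hdV dW hdW v.1
              ((p.2 v : ↥(unipDeltaLoc L e dV hdV dW hdW v.1)) : UnitaryGroup.localPi L (IsCMField.complexConj L) (2 + 2) (hermD L e dV hdV dW hdW) v.1)) : ℂ)) *
        (FinfT j S h s (UnitaryGroup.archPart (Fp L) L (IsCMField.complexConj L) (2 + 2) (hermD L e dV hdV dW hdW) (SiegelDoubled.weylDelta L e dV hdV dW hdW) *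
              (p.1 : UnitaryGroup.arch (Fp L) L (IsCMField.complexConj L) (2 + 2) (hermD L e dV hdV dW hdW)) *
              UnitaryGroup.archPart (Fp L) L (IsCMField.complexConj L) (2 + 2) (hermD L e dV hdV dW hdW) h) *
          ∏ v : (kindWFinset L e dV hdV dW hdW T₀ (S : Matrix (Fin 2) (Fin 2) L) h), FvT j S h v s (UnitaryGroup.evalPlace (Fp L) L (IsCMField.complexConj L) (2 + 2) (hermD L e dV hdV dW hdW) v.1
                (UnitaryGroup.finPart (Fp L) L (IsCMField.complexConj L) (2 + 2) (hermD L e dV hdV dW hdW) (SiegelDoubled.weylDelta L e dV hdV dW hdW)) *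
              ((p.2 v : ↥(unipDeltaLoc L e dV hdV dW hdW v.1)) : UnitaryGroup.localPi L (IsCMField.complexConj L) (2 + 2) (hermD L e dV hdV dW hdW) v.1) *
              UnitaryGroup.evalPlace (Fp L) L (IsCMField.complexConj L) (2 + 2) (hermD L e dV hdV dW hdW) v.1
                (UnitaryGroup.finPart (Fp L) L (IsCMField.complexConj L) (2 + 2) (hermD L e dV hdV dW hdW) h))))
        ((νinf (kindWFinset L e dV hdV dW hdW T₀ (S : Matrix (Fin 2) (Fin 2) L) h)).prod
          (Measure.pi fun v : (kindWFinset L e dV hdV dW hdW T₀ (S : Matrix (Fin 2) (Fin 2) L) h) => νv v.1)) := by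
  have hintArch := hintArch_of_std L e dV hdV dW hdW hdV0 hdW0 ht 𝒦 h𝒦 s₀ A hAlaw hfin hAc T₀ νinf FinfT hreadArch
  exact hint_joint_of_reading L e dV hdV dW hdW hdV0 hdW0 T₀ νinf νv hχu 𝒦 s₀ hχS₀ FinfT b hb FvT hread hintArch

end Summit.HodgeConjecture.HodgeConjecture.Cruxes.HLiu418.K2LiuKindWJointIntegrableOfRecord

end
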